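import Summits.CriticalPhenomena.PercolationContinuityZ3.Theorems.PercNearOneGluingNoHeavyLowerTailKnQuestion8CoefficientwiseCoreClassDom
import HarnessLib

/-!
# THEOREM R_A-DOM: pocket-free middle graphs carry an explicit domination map, hence CW-PA on the core class `N(x) = N(z) = {a, b}`

Support file (`--supports stmt-CriticalPhenomena-4575`, closed), prover `prim-cplus-coupling` (gen 30).  No definitions, no notations, no named facts,
no sorries; standard axioms.  Memo `prim-cplus-coupling/A5-COUPLING-gen30.md` §1–§2.  Companion `…CoreClassDom` (THEOREM KB-DOM: a domination map of
`(H; a, b)` gives the coefficientwise first rung on the core class for all monotone `f, g`).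

Setting: a finite multigraph `ends : ι → Sym2 V`, edge set `E` (the middle graph `H`), terminals `a, b`; colourings `ω ⊆ E`, `R_v(ω) = C_v(ω)`,
`B_v(ω) = C_v(E ∖ ω)`; wall event `T = {b ∉ R_a(ω)} ∩ {b ∉ B_a(ω)}`.

THE INVOLUTION `R_A`.  For `ω ⊆ E` let `P = R_a(ω)` and let `F(ω) ⊆ E` be the set of edges of `E` meeting NO vertex of `P`; put `R_A(ω) = ω ∆ F(ω)`
(recolour every edge away from `P`, keep every edge at `P`).  Then (this file):
* `Coefficientwise.openCluster_toggleOff_eq` — `R_a(R_A ω) = R_a(ω)` (the edges at `P` are untouched; closed-set principle both ways);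
* `Coefficientwise.toggleOff_toggleOff` — `R_A (R_A ω) = ω` (same `P`, same `F`): `R_A` is an involution of `2^E`, in particular injective;
* `Coefficientwise.openCluster_sdiff_off_subset_toggleOff` — `B_b^{H − P}(ω) ⊆ R_b(R_A ω)`: the blue cluster of `b` in the graph of edges away from `P`
  becomes red.
Hence `R_a(R_A ω) ∪ R_b(R_A ω) ⊇ P ∪ B_b^{H−P}(ω)`, and `R_A` is a DOMINATION MAP as soon as `(H; a, b)` is POCKET-FREE: for every `ω ∈ T`, every vertex of
`B_b(ω)` outside `R_a(ω)` is joined to `b` by a blue path avoiding `R_a(ω)` (`B_b(ω) ⊆ R_a(ω) ∪ B_b^{H − R_a(ω)}(ω)`).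
* `Coefficientwise.cwpa_coreClass_of_pocketFree` — **CW-PA (all monotone `f, g`) on the core class over every pocket-free middle graph**, by
  `cwpa_coreClass_of_dom`.
* `Coefficientwise.cwpa_coreClass_of_adj` — COROLLARY: if `a` is joined by an edge of `E_H` to every vertex of `H` other than `b` that lies on an
  edge of `E_H`, then `(H; a, b)` is pocket-free (a vertex `w ≠ b` of `B_b ∖ R_a` would be joined to `a` by a red edge — `w ∈ R_a` — or a blue one —
  `a ∈ B_b`, off the wall), so CW-PA holds; the middle graph is otherwise ARBITRARY (an infinite family outside the series–parallel/decoration/apex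
  calculus of prim-lf-2: neither terminal of `G = H + x + z` is an apex and `G − {x, z} = H` is connected).
Pocket-free also contains every `a–b` path and is closed under parallel composition at `{a, b}` (memo §1: all bundles `Θ(k₁,…,k_r)` in place of the
edge `ab` of `W₀ = K₄ − xz`), and 681 of the 1,125 'taut' two-terminal graphs on `≤ 6` vertices (memo §2); the remaining taut graphs still have
(non-canonical) domination maps through `n = 7` (27,890 ordered instances, Hall's condition by max-flow) — CONJECTURE DOM-TAUT.
[cite: KozmaNitzan2024, Questions 8–9 (§5.5 p. 36) (context: the Question-8 pocket covariance programme)]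
-/

namespace Summit.CriticalPhenomena.PercolationContinuityZ3.Theorems

open Finset Literature.Probability.Percolation
open scoped symmDiff

namespace Coefficientwise

variable {ι V : Type*}

open Classical in
/-- **`R_A` keeps the red cluster of `a`.**  With `P = C_a(ω)` and `F = {i ∈ E : no end of i lies in P}`: `C_a(ω ∆ F) = C_a(ω)`.
[cite: KozmaNitzan2024, §5.5 (context only)] -/
theorem openCluster_toggleOff_eq (ends : ι → Sym2 V) (E ω : Finset ι) (a : V) :
    openCluster (ends '' (↑(ω ∆ E.filter (fun i => ∀ v, v ∈ ends i → v ∉ openCluster (ends '' (↑ω : Set ι)) a)) : Set ι)) a =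
      openCluster (ends '' (↑ω : Set ι)) a := by
  set P : Set V := openCluster (ends '' (↑ω : Set ι)) a with hP
  set F : Finset ι := E.filter (fun i => ∀ v, v ∈ ends i → v ∉ P) with hF
  apply Set.Subset.antisymm
  · -- `P` is closed under the edges of `ω ∆ F`: such an edge at a vertex of `P` is not in `F`, hence in `ω`
    refine openCluster_subset_of_closed ends (ω ∆ F) a (S := P) (mem_openCluster_self _ _) ?_
    intro i hi u v he hu
    have hiF : i ∉ F := by
      intro hiF
      rw [hF, Finset.mem_filter] at hiF
      exact hiF.2 u (by rw [he]; exact Sym2.mem_mk_left u v) hu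
    have hiω : i ∈ ω := by
      rw [Finset.mem_symmDiff] at hi
      rcases hi with ⟨h, _⟩ | ⟨h, _⟩
      · exact h
      · exact absurd h hiF
    exact mem_openCluster_of_edge ends hiω he hu
  · -- `P ⊆ C_a(ω \ F) ⊆ C_a(ω ∆ F)`
    have hsub : ω \ F ⊆ ω ∆ F := by
      intro i hi
      rw [Finset.mem_sdiff] at hi
      rw [Finset.mem_symmDiff]
      exact Or.inl ⟨hi.1, hi.2⟩
    refine le_trans ?_ (openCluster_image_mono ends hsub a)
    set S : Set V := openCluster (ends '' (↑(ω \ F) : Set ι)) a with hS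
    have hSP : S ⊆ P := openCluster_image_mono ends Finset.sdiff_subset a
    refine openCluster_subset_of_closed ends ω a (S := S) (mem_openCluster_self _ _) ?_
    intro i hi u v he hu
    have hiF : i ∉ F := by
      intro hiF
      rw [hF, Finset.mem_filter] at hiF
      exact hiF.2 u (by rw [he]; exact Sym2.mem_mk_left u v) (hSP hu)
    exact mem_openCluster_of_edge ends (Finset.mem_sdiff.mpr ⟨hi, hiF⟩) he hu

open Classical in
/-- **`R_A` is an involution** (`P`, hence `F`, is the same before and after). [cite: KozmaNitzan2024, §5.5 (context only)] -/
theorem toggleOff_toggleOff (ends : ι → Sym2 V) (E ω : Finset ι) (a : V) :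
    (fun ω' : Finset ι => ω' ∆ E.filter (fun i => ∀ v, v ∈ ends i → v ∉ openCluster (ends '' (↑ω' : Set ι)) a))
      ((fun ω' : Finset ι => ω' ∆ E.filter (fun i => ∀ v, v ∈ ends i → v ∉ openCluster (ends '' (↑ω' : Set ι)) a)) ω) = ω := by
  beta_reduce
  rw [openCluster_toggleOff_eq ends E ω a]
  ext i
  simp only [Finset.mem_symmDiff, Finset.mem_filter]
  tauto

open Classical in
/-- **The blue cluster of `b` away from `P` turns red under `R_A`.**  With `P = C_a(ω)`, `F` the edges of `E` away from `P`:
`C_b((E ∖ ω) ∩ F) ⊆ C_b(ω ∆ F)`.  [cite: KozmaNitzan2024, §5.5 (context only)] -/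
theorem openCluster_sdiff_off_subset_toggleOff (ends : ι → Sym2 V) (E ω : Finset ι) (a b : V) :
    openCluster (ends '' (↑((E \ ω).filter (fun i => ∀ v, v ∈ ends i → v ∉ openCluster (ends '' (↑ω : Set ι)) a)) : Set ι)) b ⊆
      openCluster (ends '' (↑(ω ∆ E.filter (fun i => ∀ v, v ∈ ends i → v ∉ openCluster (ends '' (↑ω : Set ι)) a)) : Set ι)) b := by
  refine openCluster_image_mono ends (fun i hi => ?_) b
  rw [Finset.mem_filter, Finset.mem_sdiff] at hi
  rw [Finset.mem_symmDiff, Finset.mem_filter]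
  exact Or.inr ⟨⟨hi.1.1, hi.2⟩, hi.1.2⟩

open Classical in
/-- **THEOREM R_A-DOM — CW-PA on the core class over a pocket-free middle graph.**  Core class as in `cwpa_coreClass_of_dom`
(`E₀ = E_H ∪ {ixa, ixb, iza, izb}`, no edge of `E_H` at `x` or `z`).  POCKET-FREE hypothesis: for every `ω ⊆ E_H` in the wall event of `(H; a, b)`,
`C_b(E_H ∖ ω) ⊆ C_a(ω) ∪ C_b({i ∈ E_H ∖ ω : i meets no vertex of C_a(ω)})` (every vertex of the blue cluster of `b` outside the red cluster `P` of `a`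
is joined to `b` by a blue path avoiding `P`).  Then for ALL monotone `f, g`:
`0 ≤ Σ_{s ⊆ E₀ : z ∉ C_x(s), z ∉ C_x(E₀∖s)} f(C_x s)·(g(C_x s) − g(C_x(E₀∖s)))`.  The domination map is `R_A(ω) = ω ∆ {edges away from C_a(ω)}`.
[cite: KozmaNitzan2024, Questions 8–9 (§5.5 p. 36) (context)] -/
theorem cwpa_coreClass_of_pocketFree (ends : ι → Sym2 V) (EH E₀ : Finset ι) (x z a b : V) (ixa ixb iza izb : ι)
    (hxa : ends ixa = s(x, a)) (hxb : ends ixb = s(x, b)) (hza : ends iza = s(z, a)) (hzb : ends izb = s(z, b))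
    (hH : ∀ i ∈ EH, x ∉ ends i ∧ z ∉ ends i) (hE₀ : ∀ i, i ∈ E₀ ↔ i ∈ EH ∨ i = ixa ∨ i = ixb ∨ i = iza ∨ i = izb)
    (hnot : ixa ∉ EH ∧ ixb ∉ EH ∧ iza ∉ EH ∧ izb ∉ EH)
    (hd : ixa ≠ ixb ∧ ixa ≠ iza ∧ ixa ≠ izb ∧ ixb ≠ iza ∧ ixb ≠ izb ∧ iza ≠ izb)
    (hxz : x ≠ z) (hxa' : x ≠ a) (hxb' : x ≠ b) (hza' : z ≠ a) (hzb' : z ≠ b)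
    (hpf : ∀ ω, ω ⊆ EH → b ∉ openCluster (ends '' (↑ω : Set ι)) a → b ∉ openCluster (ends '' (↑(EH \ ω) : Set ι)) a →
      openCluster (ends '' (↑(EH \ ω) : Set ι)) b ⊆ openCluster (ends '' (↑ω : Set ι)) a ∪
        openCluster (ends '' (↑((EH \ ω).filter (fun i => ∀ v, v ∈ ends i → v ∉ openCluster (ends '' (↑ω : Set ι)) a)) : Set ι)) b)
    (f g : Set V → ℝ) (hf : Monotone f) (hg : Monotone g) :
    0 ≤ ∑ s ∈ E₀.powerset.filter (fun s : Finset ι => z ∉ openCluster (ends '' (↑s : Set ι)) x ∧ z ∉ openCluster (ends '' (↑(E₀ \ s) : Set ι)) x),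
      f (openCluster (ends '' (↑s : Set ι)) x) * (g (openCluster (ends '' (↑s : Set ι)) x) - g (openCluster (ends '' (↑(E₀ \ s) : Set ι)) x)) := by
  -- the domination map `R_A`
  refine cwpa_coreClass_of_dom ends EH E₀ x z a b ixa ixb iza izb hxa hxb hza hzb hH hE₀ hnot hd hxz hxa' hxb' hza' hzb'
    (fun ω => ω ∆ EH.filter (fun i => ∀ v, v ∈ ends i → v ∉ openCluster (ends '' (↑ω : Set ι)) a)) ?_ ?_ ?_ f g hf hg
  · -- stays inside `E_H`
    intro ω hω _ _ i hi
    rw [Finset.mem_symmDiff, Finset.mem_filter] at hi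
    rcases hi with ⟨h, _⟩ | ⟨h, _⟩
    · exact hω h
    · exact h.1
  · -- coverage
    intro ω hω hbR hbB
    rw [openCluster_toggleOff_eq ends EH ω a]
    intro y hy
    rcases hy with hy | hy
    · exact Or.inl hy
    · rcases hpf ω hω hbR hbB hy with h | h
      · exact Or.inl h
      · exact Or.inr (openCluster_sdiff_off_subset_toggleOff ends EH ω a b h)
  · -- injectivity (involution)
    intro ω₁ ω₂ _ _ _ _ _ _ h
    have h1 := toggleOff_toggleOff ends EH ω₁ a
    have h2 := toggleOff_toggleOff ends EH ω₂ a
    beta_reduce at h1 h2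
    rw [← h1, ← h2, h]

open Classical in
/-- **COROLLARY — `a` adjacent to everything but `b`.**  In the core class over a middle graph `H = (V, E_H)` in which every vertex `w ≠ a, b` lying on
an edge of `E_H` is joined to `a` by an edge of `E_H` (the rest of `H` arbitrary), CW-PA holds for all monotone `f, g`:
`0 ≤ Σ_{s ⊆ E₀ : z ∉ C_x(s), z ∉ C_x(E₀∖s)} f(C_x s)·(g(C_x s) − g(C_x(E₀∖s)))`.  (Such `(H; a, b)` is pocket-free: on the wall event
`C_b(E_H ∖ ω) ∖ C_a(ω) ⊆ {b}`.)  [cite: KozmaNitzan2024, Questions 8–9 (§5.5 p. 36) (context)] -/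
theorem cwpa_coreClass_of_adj (ends : ι → Sym2 V) (EH E₀ : Finset ι) (x z a b : V) (ixa ixb iza izb : ι)
    (hxa : ends ixa = s(x, a)) (hxb : ends ixb = s(x, b)) (hza : ends iza = s(z, a)) (hzb : ends izb = s(z, b))
    (hH : ∀ i ∈ EH, x ∉ ends i ∧ z ∉ ends i) (hE₀ : ∀ i, i ∈ E₀ ↔ i ∈ EH ∨ i = ixa ∨ i = ixb ∨ i = iza ∨ i = izb)
    (hnot : ixa ∉ EH ∧ ixb ∉ EH ∧ iza ∉ EH ∧ izb ∉ EH)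
    (hd : ixa ≠ ixb ∧ ixa ≠ iza ∧ ixa ≠ izb ∧ ixb ≠ iza ∧ ixb ≠ izb ∧ iza ≠ izb)
    (hxz : x ≠ z) (hxa' : x ≠ a) (hxb' : x ≠ b) (hza' : z ≠ a) (hzb' : z ≠ b)
    (hadj : ∀ w, w ≠ a → w ≠ b → (∃ i ∈ EH, w ∈ ends i) → ∃ j ∈ EH, ends j = s(a, w))
    (f g : Set V → ℝ) (hf : Monotone f) (hg : Monotone g) :
    0 ≤ ∑ s ∈ E₀.powerset.filter (fun s : Finset ι => z ∉ openCluster (ends '' (↑s : Set ι)) x ∧ z ∉ openCluster (ends '' (↑(E₀ \ s) : Set ι)) x),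
      f (openCluster (ends '' (↑s : Set ι)) x) * (g (openCluster (ends '' (↑s : Set ι)) x) - g (openCluster (ends '' (↑(E₀ \ s) : Set ι)) x)) := by
  refine cwpa_coreClass_of_pocketFree ends EH E₀ x z a b ixa ixb iza izb hxa hxb hza hzb hH hE₀ hnot hd hxz hxa' hxb' hza' hzb' ?_ f g hf hg
  intro ω hω hbR hbB y hy
  by_cases hyP : y ∈ openCluster (ends '' (↑ω : Set ι)) a
  · exact Or.inl hyP
  right
  by_cases hyb : y = b
  · subst hyb; exact mem_openCluster_self _ _
  -- `y ≠ a` since `a ∈ C_a(ω)`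
  have hya : y ≠ a := by
    rintro rfl; exact hyP (mem_openCluster_self _ _)
  -- `y` lies on an edge of `E_H ∖ ω ⊆ E_H`
  obtain ⟨i, hi, hyi⟩ := exists_edge_of_mem_openCluster ends hy hyb
  obtain ⟨j, hj, hje⟩ := hadj y hya hyb ⟨i, (Finset.mem_sdiff.mp hi).1, hyi⟩
  exfalso
  by_cases hjω : j ∈ ω
  · -- red edge `a–y`: `y ∈ C_a(ω)`
    exact hyP (mem_openCluster_of_edge ends hjω hje (mem_openCluster_self _ _))
  · -- blue edge `a–y`: `a ∈ C_b(E_H ∖ ω)`, i.e. `b ∈ C_a(E_H ∖ ω)`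
    have hjB : j ∈ EH \ ω := Finset.mem_sdiff.mpr ⟨hj, hjω⟩
    have hje' : ends j = s(y, a) := by rw [hje, Sym2.eq_swap]
    have haB : a ∈ openCluster (ends '' (↑(EH \ ω) : Set ι)) b := mem_openCluster_of_edge ends hjB hje' hy
    exact hbB ((mem_openCluster_comm ends (EH \ ω) a b).mpr haB)

end Coefficientwise

end Summit.CriticalPhenomena.PercolationContinuityZ3.Theorems
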